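import Literature.MathematicalPhysics.QuantumFieldTheory.Balaban1983to89.B6Eq292MemberTwoScaleV1
import Literature.MathematicalPhysics.QuantumFieldTheory.Balaban1983to89.B6Prop25GDivDecayTwoScaleV1
import Literature.MathematicalPhysics.QuantumFieldTheory.Balaban1983to89.B6Prop25LapDecayTwoScaleV1

/-!
# `Balaban1983to89.B6Ineq2133GDivLapTwoScaleV1` — T. Bałaban, *Propagators and renormalization transformations for lattice gauge theories. II*,
# Commun. Math. Phys. **96** (1984) 223–250 [Balaban1984PropagatorsII], (2.133) p. 247 × Prop. 2.6 (2.136)₃,₄ p. 247: the (2.133)-SHAPE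
# MAJORANTS OF `G_□∇_λ*` AND `ΔG_□` FOR THE GENUINE TWO-SCALE `G_□` OF (2.90), and the differentiated first / last factors
# `∇_λ(h_□G_□)`, `G_□h_□∇_λ*`, `Δ(h_□G_□)` of the expansion (2.141) on the member torus

statement-level skeleton of published theorems with citation tags; proofs where landed; nothing here is a claim about the Yang–Mills mass gap

PDF held: `paper:balaban1984-cmp96-propagators-rt-ii` (journal page = PDF page + 222); p. 247 [PDF 25] ((2.133)–(2.136), (2.141)), p. 239 [PDF 17]
((2.90)–(2.92)) re-read from the materialised text `~/.lit/texts/paper-balaban1984-cmp96-propagators-rt-ii/p0025.txt`, `p0017.txt` (this seat,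
2026-08-23); `paper:balaban1984-cmp95-propagators-rt-i` ([4] = [Balaban1984PropagatorsI]) p. 35 (1.110).

PRINT (verbatim up to notation).  p. 247: *"|(G_□J)(x)|, |(∇G_□J)(x)| ≤ O(1)[(L^jη)², L^jη]e^{−δ₂|y−y′|}|J| (2.133) for x ∈ Δ(y), supp J ⊂ Δ(y′),
y, y′ ∈ 𝔅 ∩ T_□. … Proposition 2.6. There exists a positive constant δ₃ depending on d and L only, such that |(GJ)(x)|, |(∇GJ)(x)|, |(G∇*J)(x)|,
|(ΔGJ)(x)| ≤ O(1)[(L^jη)², L^jη, L^jη, 1]e^{−δ₃d(y,y′)}|J| (2.136) … The operator G can be represented as G = G₀(I − R)⁻¹ = Σ_{n=0}^∞ G₀Rⁿ =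
Σ_n Σ_ω h_{□₀}G_{□₀}h_{□₀}K_{□₁,□₂}G_{□₂}h_{□₂} … K_{□_{2n−1},□_{2n}}G_{□_{2n}}h_{□_{2n}}, (2.141) and the series above is convergent in the norms
appearing in the inequalities (2.136)–(2.140)."*; p. 246 (Prop. 2.5): *"The operator G [= G_□] satisfies (1.110)–(1.114) [4]"* — [4] (1.110) lists
`|GJ|, |∇GJ|, |G∇*J|, |ΔGJ|` with the prefactors `[(L^kη)², L^kη, L^kη, 1]`.

CITATION HEADER (lean-in-tree rule) — WHAT IS REPRODUCED.  Phase-2 file of the `lit-balaban` typed skeleton (HOME `run/shared/lean/pub/lit-balaban/`),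
seat **p22 gen 19** (free-target protocol G.5-34(d), TAKING (a), HOME/STATUS.md 2026-08-23T02:5xZ; B6 fold owner r03, referee ref-4); SKELETON rows
**B6.Eq2.133** × **B6.Prop2.5** × **B6.Prop2.6** (member cells only; no decl of record touched).  p38's `…B6Ineq2133TwoScaleV1` put the FIRST TWO
sup entries `G_□`, `∇_λG_□` of Prop. 2.5 into the (2.133) majorant shape `HasMajorant (g := tsGeo i R M) blk (onFun ·) (A·e^{−δ₂|y−y′|_T})`
consumed by the (2.134)/(2.136)₁ chain (`…B6Prop26Gluing`, r03's `…B6GlobalChartV1`); gen 18's `…B6Eq292MemberTwoScaleV1.ineq2133_DlaG` added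
`∇_λ*G_□`.  THIS FILE adds the two REMAINING sup entries of (1.110)/(2.136) for the member — `G_□∇_λ*` ((1.110)₃, p22 F14
`…B6Prop25GDivDecayTwoScaleV1.blockBound_GDadj_scaling` BY NAME) and `ΔG_□ = (Σ_λ∇_λ*∇_λ)G_□` ((1.110)₄, p22 F22
`…B6Prop25LapDecayTwoScaleV1.blockBound_LapG_scaling` BY NAME) — and the member-torus algebra + majorants of the DIFFERENTIATED END FACTORS of
(2.141) that the (2.136)₂,₃,₄ chains (*"Reasoning in the same way as in the proof of Proposition 2.2"*) consume:
* §1 **`ineq2133_GDla`** (`onFun (G_□ ∘ ∇_λ*)`), **`ineq2133_LapG`** (`onFun (Δ ∘ G_□)`, `Δ = i.lapTS`), `_local` forms — ONE `(δ, A)` on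
  `d, L, a₀, a₁` for every member `i : TSIdx`, every `R, M`, every direction.
* §2 **`ineq2133_five`**: `G_□`, `∇_λG_□`, `∇_λ*G_□`, `G_□∇_λ*`, `ΔG_□` with ONE pair `(δ₂, A)` (`min`/`max` merge).
* §3 THE LEIBNIZ RULES FOR ONE DIFFERENCE AGAINST A MULTIPLICATION on the bond functions of the member torus (operator identities in
  `Module.End ℝ (PBond → ℝ)`): `Dl_mulOp` (`∇_λ∘h = (S_λh)∘∇_λ + (∇_λh)`), `Dla_mulOp`, `mulOp_Dla` (`h∘∇_λ* = ∇_λ*∘(S_λh) + (∇_λh)`), `mulOp_Dl`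
  — print's (1.120)/(2.92)-type commutators `[∇, h_□]`, written for the member's `∇_λ = L^j(S_λ − I)`.
* §4 THE DIFFERENTIATED END FACTORS WITH THEIR MAJORANTS, for ANY real bond function `h` with `|h| ≤ s₀`, `|∇_λh|, |∇_λ*h| ≤ s₁`, `|Δh| ≤ s₂`:
  **`firstFactor_Dl`** (`onFun ∇_λ * mulOp h * onFun G_□`, majorant `(s₀ + s₁)·A·e^{−δ₂d}` — the first factor of (2.136)₂),
  **`lastFactor_Dla`** (`onFun G_□ * mulOp h * onFun ∇_λ*`, the last factor of (2.136)₃), **`firstFactor_lap`** (`onFun Δ * mulOp h * onFun G_□`,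
  majorant `(s₀ + 2(d+1)s₁ + s₂)·A·e^{−δ₂d}` — the first factor of (2.136)₄, through gen 18's `leibniz_lapTS`).
THEOREMS ONLY (no `def`, no `def … : Prop`, no new hypothesis); standard axioms; imports BY NAME, restating nothing.

HONEST SCOPE / DIVERGENCES. (1) ξ-units of the member (`L^jη = 1` on `tsGeo`): all four prefactors of (2.136) read `1` here; the factors
`(L^{j(y)}/c′)^{±k}` of the global lattice are r03's transplant ((d5), `…B6AgreeLapV1Chart` F1). (2) `h` is ANY real function of the fine bonds with the
three sup bounds as hypotheses — the sizes `s₁ = O(M⁻¹)`, `s₂ = O(M⁻²)` of the (1.118) family are p38's `…B6Partition118KLevelFine*`; nothing about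
`h` is assumed beyond the displayed bounds. (3) These are INPUTS of the (2.136)₂,₃,₄ / (2.141) chains at `k` levels (owner r03, (d5)); the chains
themselves, the Hölder/`L²` members (2.137)–(2.140) and the verbatim census `B6.Prop26Printed` are NOT claimed. (4) Constants crude and ours
(`min` of rates, sums of constants).  NOT summit progress.  Unit `lit-balaban-p22` (gen 19), 2026-08-23.
-/

noncomputable section

open scoped BigOperators
open Finset

namespace Literature.MathematicalPhysics.QuantumFieldTheory.Balaban1983to89.B6Ineq2133GDivLapTwoScaleV1

open LatticeFieldCalculus B5Eq117TorusCarriers B6SectAOperatorsV1 B6SectCOperators B6SectCTwoScaleV1 B6SectCTwoScaleV1Lattice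
open BalabanImbrieJaffe1984to88.BIJ85AxialPropagator411 (BondSpace)
open B5Eq118OneStroke (iterBlockOf)
open B6RandomWalk (HasMajorant BlockSupp hasMajorant_mono hasMajorant_add)
open B6Prop26Gluing (mulOp mulOp_apply LocalMajorant localMajorant_of_hasMajorant hasMajorant_finsetSum)
open B6Ineq2133TwoScaleV1 (onFun onFun_apply tsGeo hasMajorant_of_blockBound ineq2133_G ineq2133_DG)
open B6Eq292MemberTwoScaleV1 (ineq2133_DlaG leibniz_lapTS)
open B6Prop25GDivDecayTwoScaleV1 (blockBound_GDadj_scaling)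
open B6Prop25LapDecayTwoScaleV1 (blockBound_LapG_scaling)
open B6Prop25TwoScaleCensus (TSIdx)

variable {d L : ℕ} {hd : 1 ≤ d + 1} {hL : Odd L ∧ 1 < L} {a₀ a₁ : ℝ}

/-! ## §1  (2.133)-shape majorants of `G_□∇_λ*` and `ΔG_□` -/

open Classical in
/-- **`G_□∇_λ*` HAS THE (2.133) MAJORANT ON THE MEMBER GEOMETRY** (the third sup entry of (1.110)/(2.136) for the genuine two-scale `G_□`): there are
`δ > 0`, `A ≥ 0` on `d, L, a₀, a₁` only such that for every member `i`, every `R, M` and every direction `λ`,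
`HasMajorant (g := tsGeo i R M) y(·₋) (onFun (G_□ ∘ ∇_λ*)) (A·e^{−δ|y−y′|_T})` — p22 F14's `blockBound_GDadj_scaling` ((1.110)₃ for the composite
`G_□` of (2.129)) BY NAME. [cite: Balaban1984PropagatorsII, (2.133) p.247, Prop. 2.6 (2.136) p.247 («|(G∇*J)(x)|»); Balaban1984PropagatorsI, (1.110) p.35] -/
theorem ineq2133_GDla (d L : ℕ) (hd : 1 ≤ d + 1) (hL : Odd L ∧ 1 < L) {a₀ a₁ : ℝ} (ha₀ : 0 < a₀) (ha₁ : a₀ ≤ a₁) :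
    ∃ δ : ℝ, 0 < δ ∧ ∃ A : ℝ, 0 ≤ A ∧ ∀ (i : TSIdx d L hd hL a₀ a₁) (R M : ℝ) (lam : Fin i.P.d),
      HasMajorant (g := tsGeo i R M) (fun b : PBond i.P 0 => iterBlockOf i.j b.src) (onFun (i.D.G ∘ₗ i.Dla lam))
        (fun y y' => A * Real.exp (-(δ * i.tdist y y'))) := by
  obtain ⟨δ, hδ, C, hC, h⟩ := blockBound_GDadj_scaling d L hd hL ha₀ ha₁
  refine ⟨δ, hδ, C, hC, fun i R M lam => hasMajorant_of_blockBound i R M (i.D.G ∘ₗ i.Dla lam) fun b y => ?_⟩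
  exact h i.m i.K i.j i.hc i.hj i.Λ' i.w i.hw0 i.hw1 lam b y

open Classical in
/-- **`ΔG_□ = (Σ_λ∇_λ*∇_λ)G_□` HAS THE (2.133) MAJORANT ON THE MEMBER GEOMETRY** (the fourth sup entry of (1.110)/(2.136) for the genuine two-scale
`G_□`; `Δ = i.lapTS`, r03's census Laplacian = the member's `∂*∂ + ∂∂*` by gen 18's `lapV_member_eq_lapTS`): ONE `(δ, A)` on `d, L, a₀, a₁` — p22
F22's `blockBound_LapG_scaling` ((1.110)₄) BY NAME. [cite: Balaban1984PropagatorsII, (2.133) p.247, Prop. 2.6 (2.136) p.247 («|(ΔGJ)(x)|»); Balaban1984PropagatorsI, (1.110) p.35] -/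
theorem ineq2133_LapG (d L : ℕ) (hd : 1 ≤ d + 1) (hL : Odd L ∧ 1 < L) {a₀ a₁ : ℝ} (ha₀ : 0 < a₀) (ha₁ : a₀ ≤ a₁) :
    ∃ δ : ℝ, 0 < δ ∧ ∃ A : ℝ, 0 ≤ A ∧ ∀ (i : TSIdx d L hd hL a₀ a₁) (R M : ℝ),
      HasMajorant (g := tsGeo i R M) (fun b : PBond i.P 0 => iterBlockOf i.j b.src) (onFun (i.lapTS ∘ₗ i.D.G))
        (fun y y' => A * Real.exp (-(δ * i.tdist y y'))) := by
  obtain ⟨δ, hδ, C, hC, h⟩ := blockBound_LapG_scaling d L hd hL ha₀ ha₁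
  refine ⟨δ, hδ, C, hC, fun i R M => hasMajorant_of_blockBound i R M (i.lapTS ∘ₗ i.D.G) fun b y => ?_⟩
  exact h i.m i.K i.j i.hc i.hj i.Λ' i.w i.hw0 i.hw1 b y

/-- the local shape (`LocalMajorant` on any reach set `S`) for `G_□∇_λ*`. [cite: Balaban1984PropagatorsII, (2.133) p.247, (2.136) p.247] -/
theorem ineq2133_GDla_local (d L : ℕ) (hd : 1 ≤ d + 1) (hL : Odd L ∧ 1 < L) {a₀ a₁ : ℝ} (ha₀ : 0 < a₀) (ha₁ : a₀ ≤ a₁) :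
    ∃ δ : ℝ, 0 < δ ∧ ∃ A : ℝ, 0 ≤ A ∧ ∀ (i : TSIdx d L hd hL a₀ a₁) (R M : ℝ) (lam : Fin i.P.d) (S : Set (Site i.P i.j)),
      LocalMajorant (g := tsGeo i R M) (fun b : PBond i.P 0 => iterBlockOf i.j b.src) (onFun (i.D.G ∘ₗ i.Dla lam)) S
        (fun y y' => A * Real.exp (-(δ * i.tdist y y'))) := by
  obtain ⟨δ, hδ, A, hA, h⟩ := ineq2133_GDla d L hd hL ha₀ ha₁
  exact ⟨δ, hδ, A, hA, fun i R M lam S => localMajorant_of_hasMajorant (g := tsGeo i R M) _ (h i R M lam) S⟩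

/-- the local shape for `ΔG_□`. [cite: Balaban1984PropagatorsII, (2.133) p.247, (2.136) p.247] -/
theorem ineq2133_LapG_local (d L : ℕ) (hd : 1 ≤ d + 1) (hL : Odd L ∧ 1 < L) {a₀ a₁ : ℝ} (ha₀ : 0 < a₀) (ha₁ : a₀ ≤ a₁) :
    ∃ δ : ℝ, 0 < δ ∧ ∃ A : ℝ, 0 ≤ A ∧ ∀ (i : TSIdx d L hd hL a₀ a₁) (R M : ℝ) (S : Set (Site i.P i.j)),
      LocalMajorant (g := tsGeo i R M) (fun b : PBond i.P 0 => iterBlockOf i.j b.src) (onFun (i.lapTS ∘ₗ i.D.G)) S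
        (fun y y' => A * Real.exp (-(δ * i.tdist y y'))) := by
  obtain ⟨δ, hδ, A, hA, h⟩ := ineq2133_LapG d L hd hL ha₀ ha₁
  exact ⟨δ, hδ, A, hA, fun i R M S => localMajorant_of_hasMajorant (g := tsGeo i R M) _ (h i R M) S⟩

/-! ## §2  All five difference-dressed members with ONE pair of constants -/

/-- monotonicity of the exponential majorant in the constant and the rate (non-negative distances). [folklore] -/
private theorem expMajorant_mono {A A' δ δ' t : ℝ} (hA : A ≤ A') (hA' : 0 ≤ A') (hδ : δ' ≤ δ) (ht : 0 ≤ t) :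
    A * Real.exp (-(δ * t)) ≤ A' * Real.exp (-(δ' * t)) :=
  (mul_le_mul_of_nonneg_right hA (Real.exp_nonneg _)).trans
    (mul_le_mul_of_nonneg_left (Real.exp_le_exp.mpr (neg_le_neg (mul_le_mul_of_nonneg_right hδ ht))) hA')

/-- **THE FIVE MEMBERS `G_□`, `∇_λG_□`, `∇_λ*G_□`, `G_□∇_λ*`, `ΔG_□` WITH ONE `(δ₂, A)`** (as printed: one `O(1)`, one rate, for all sup entries): there are
`δ₂ > 0`, `A ≥ 0` on `d, L, a₀, a₁` such that for every member, every `R, M` (and every direction) each of the five transported operators has the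
majorant `A·e^{−δ₂|y−y′|_T}` on `tsGeo i R M` — p38's `ineq2133_G`/`ineq2133_DG`, gen 18's `ineq2133_DlaG`, §1, merged by `hasMajorant_mono`.
[cite: Balaban1984PropagatorsII, (2.133) p.247, Prop. 2.6 (2.136) p.247; Balaban1984PropagatorsI, (1.110) p.35] -/
theorem ineq2133_five (d L : ℕ) (hd : 1 ≤ d + 1) (hL : Odd L ∧ 1 < L) {a₀ a₁ : ℝ} (ha₀ : 0 < a₀) (ha₁ : a₀ ≤ a₁) :
    ∃ δ : ℝ, 0 < δ ∧ ∃ A : ℝ, 0 ≤ A ∧ ∀ (i : TSIdx d L hd hL a₀ a₁) (R M : ℝ),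
      HasMajorant (g := tsGeo i R M) (fun b : PBond i.P 0 => iterBlockOf i.j b.src) (onFun i.D.G)
          (fun y y' => A * Real.exp (-(δ * i.tdist y y'))) ∧
        (∀ lam : Fin i.P.d, HasMajorant (g := tsGeo i R M) (fun b : PBond i.P 0 => iterBlockOf i.j b.src) (onFun (i.Dl lam ∘ₗ i.D.G))
          (fun y y' => A * Real.exp (-(δ * i.tdist y y')))) ∧
        (∀ lam : Fin i.P.d, HasMajorant (g := tsGeo i R M) (fun b : PBond i.P 0 => iterBlockOf i.j b.src) (onFun (i.Dla lam ∘ₗ i.D.G))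
          (fun y y' => A * Real.exp (-(δ * i.tdist y y')))) ∧
        (∀ lam : Fin i.P.d, HasMajorant (g := tsGeo i R M) (fun b : PBond i.P 0 => iterBlockOf i.j b.src) (onFun (i.D.G ∘ₗ i.Dla lam))
          (fun y y' => A * Real.exp (-(δ * i.tdist y y')))) ∧
        HasMajorant (g := tsGeo i R M) (fun b : PBond i.P 0 => iterBlockOf i.j b.src) (onFun (i.lapTS ∘ₗ i.D.G))
          (fun y y' => A * Real.exp (-(δ * i.tdist y y'))) := by
  obtain ⟨δ₁, hδ₁, A₁, hA₁, h₁⟩ := ineq2133_G d L hd hL ha₀ ha₁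
  obtain ⟨δ₂, hδ₂, A₂, hA₂, h₂⟩ := ineq2133_DG d L hd hL ha₀ ha₁
  obtain ⟨δ₃, hδ₃, A₃, hA₃, h₃⟩ := ineq2133_DlaG d L hd hL ha₀ ha₁
  obtain ⟨δ₄, hδ₄, A₄, hA₄, h₄⟩ := ineq2133_GDla d L hd hL ha₀ ha₁
  obtain ⟨δ₅, hδ₅, A₅, hA₅, h₅⟩ := ineq2133_LapG d L hd hL ha₀ ha₁
  set δ : ℝ := min (min (min (min δ₁ δ₂) δ₃) δ₄) δ₅ with hδdef
  set A : ℝ := max (max (max (max A₁ A₂) A₃) A₄) A₅ with hAdef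
  have hδ : 0 < δ := lt_min (lt_min (lt_min (lt_min hδ₁ hδ₂) hδ₃) hδ₄) hδ₅
  have hA : 0 ≤ A := hA₅.trans (le_max_right _ _)
  have hd1 : δ ≤ δ₁ := (min_le_left _ _).trans ((min_le_left _ _).trans ((min_le_left _ _).trans (min_le_left _ _)))
  have hd2 : δ ≤ δ₂ := (min_le_left _ _).trans ((min_le_left _ _).trans ((min_le_left _ _).trans (min_le_right _ _)))
  have hd3 : δ ≤ δ₃ := (min_le_left _ _).trans ((min_le_left _ _).trans (min_le_right _ _))
  have hd4 : δ ≤ δ₄ := (min_le_left _ _).trans (min_le_right _ _)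
  have hd5 : δ ≤ δ₅ := min_le_right _ _
  have hA1 : A₁ ≤ A := (le_max_left _ _).trans ((le_max_left _ _).trans ((le_max_left _ _).trans (le_max_left _ _)))
  have hA2 : A₂ ≤ A := (le_max_right _ _).trans ((le_max_left _ _).trans ((le_max_left _ _).trans (le_max_left _ _)))
  have hA3 : A₃ ≤ A := (le_max_right _ _).trans ((le_max_left _ _).trans (le_max_left _ _))
  have hA4 : A₄ ≤ A := (le_max_right _ _).trans (le_max_left _ _)
  have hA5 : A₅ ≤ A := le_max_right _ _
  refine ⟨δ, hδ, A, hA, fun i R M => ⟨?_, fun lam => ?_, fun lam => ?_, fun lam => ?_, ?_⟩⟩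
  · exact hasMajorant_mono _ (h₁ i R M) fun a b => expMajorant_mono hA1 hA hd1 (i.tdist_nonneg a b)
  · exact hasMajorant_mono _ (h₂ i R M lam) fun a b => expMajorant_mono hA2 hA hd2 (i.tdist_nonneg a b)
  · exact hasMajorant_mono _ (h₃ i R M lam) fun a b => expMajorant_mono hA3 hA hd3 (i.tdist_nonneg a b)
  · exact hasMajorant_mono _ (h₄ i R M lam) fun a b => expMajorant_mono hA4 hA hd4 (i.tdist_nonneg a b)
  · exact hasMajorant_mono _ (h₅ i R M) fun a b => expMajorant_mono hA5 hA hd5 (i.tdist_nonneg a b)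

/-! ## §3  The Leibniz rules for one difference against a multiplication (member torus) -/

section Leibniz

variable (i : TSIdx d L hd hL a₀ a₁)

/-- **`∇_λ(hA) = (S_λh)·∇_λA + (∇_λh)·A`** as an operator identity on the bond functions of the member torus:
`onFun ∇_λ * mulOp h = mulOp (h ∘ S_λ) * onFun ∇_λ + mulOp (∇_λh)` (`(S_λh)(b) = h(b + e_λ)`, `∇_λ = L^j(S_λ − I)`).
[cite: Balaban1984PropagatorsII, (2.92) p.239 («(∂h_□)(b)(∂A_μ)(b)»); Balaban1984PropagatorsI, (1.120) p.37 («[·, h]»)] -/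
theorem Dl_mulOp (lam : Fin i.P.d) (h : PBond i.P 0 → ℝ) :
    onFun (i.Dl lam) * mulOp h =
      mulOp (fun b : PBond i.P 0 => h ⟨b.src.shift lam, b.dir⟩) * onFun (i.Dl lam) + mulOp (onFun (i.Dl lam) h) := by
  apply LinearMap.ext
  intro A
  funext b
  simp only [Module.End.mul_apply, LinearMap.add_apply, Pi.add_apply, mulOp_apply, onFun_apply, TSIdx.Dl_apply]
  ring

/-- **`∇_λ*(hA) = (S_λ⁻¹h)·∇_λ*A + (∇_λ*h)·A`**: `onFun ∇_λ* * mulOp h = mulOp (h ∘ S_λ⁻¹) * onFun ∇_λ* + mulOp (∇_λ*h)`.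
[cite: Balaban1984PropagatorsII, (2.92) p.239; Balaban1984PropagatorsI, (1.120) p.37] -/
theorem Dla_mulOp (lam : Fin i.P.d) (h : PBond i.P 0 → ℝ) :
    onFun (i.Dla lam) * mulOp h =
      mulOp (fun b : PBond i.P 0 => h ⟨b.src.unshift lam, b.dir⟩) * onFun (i.Dla lam) + mulOp (onFun (i.Dla lam) h) := by
  apply LinearMap.ext
  intro A
  funext b
  simp only [Module.End.mul_apply, LinearMap.add_apply, Pi.add_apply, mulOp_apply, onFun_apply, TSIdx.Dla_apply]
  ring

/-- **`h·∇_λ*A = ∇_λ*((S_λh)A) + (∇_λh)·A`** (the multiplication moved THROUGH a backward difference to the source side):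
`mulOp h * onFun ∇_λ* = onFun ∇_λ* * mulOp (h ∘ S_λ) + mulOp (∇_λh)` — since `(S_λh)(b − e_λ) = h(b)` and `L^j(h(b) − h(b + e_λ)) = −(∇_λh)(b)`.
[cite: Balaban1984PropagatorsII, (2.92) p.239, (2.136) p.247 («G∇*J»); Balaban1984PropagatorsI, (1.120) p.37] -/
theorem mulOp_Dla (lam : Fin i.P.d) (h : PBond i.P 0 → ℝ) :
    mulOp h * onFun (i.Dla lam) =
      onFun (i.Dla lam) * mulOp (fun b : PBond i.P 0 => h ⟨b.src.shift lam, b.dir⟩) + mulOp (onFun (i.Dl lam) h) := by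
  apply LinearMap.ext
  intro A
  funext b
  simp only [Module.End.mul_apply, LinearMap.add_apply, Pi.add_apply, mulOp_apply, onFun_apply, TSIdx.Dla_apply, TSIdx.Dl_apply]
  rw [show (⟨(⟨b.src.unshift lam, b.dir⟩ : PBond i.P 0).src.shift lam, (⟨b.src.unshift lam, b.dir⟩ : PBond i.P 0).dir⟩ : PBond i.P 0) = b by
    rw [show (⟨b.src.unshift lam, b.dir⟩ : PBond i.P 0).src = b.src.unshift lam from rfl, B10StarCount.shift_unshift]]
  ring

/-- **`h·∇_λA = ∇_λ((S_λ⁻¹h)A) + (∇_λ*h)·A`**: `mulOp h * onFun ∇_λ = onFun ∇_λ * mulOp (h ∘ S_λ⁻¹) + mulOp (∇_λ*h)`.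
[cite: Balaban1984PropagatorsII, (2.92) p.239; Balaban1984PropagatorsI, (1.120) p.37] -/
theorem mulOp_Dl (lam : Fin i.P.d) (h : PBond i.P 0 → ℝ) :
    mulOp h * onFun (i.Dl lam) =
      onFun (i.Dl lam) * mulOp (fun b : PBond i.P 0 => h ⟨b.src.unshift lam, b.dir⟩) + mulOp (onFun (i.Dla lam) h) := by
  apply LinearMap.ext
  intro A
  funext b
  simp only [Module.End.mul_apply, LinearMap.add_apply, Pi.add_apply, mulOp_apply, onFun_apply, TSIdx.Dla_apply, TSIdx.Dl_apply]
  rw [show (⟨(⟨b.src.shift lam, b.dir⟩ : PBond i.P 0).src.unshift lam, (⟨b.src.shift lam, b.dir⟩ : PBond i.P 0).dir⟩ : PBond i.P 0) = b by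
    rw [show (⟨b.src.shift lam, b.dir⟩ : PBond i.P 0).src = b.src.shift lam from rfl, B10StarCount.unshift_shift]]
  ring

end Leibniz

/-! ## §4  The differentiated end factors of (2.141) with their majorants -/

section Factors

variable {g : B6.Geometry} {X : Type}

/-- a multiplier bounded by `s` in front scales a majorant by `s`. [folklore] -/
private theorem hasMajorant_mulOp_left_le (blk : X → g.Site) {T : Module.End ℝ (X → ℝ)} {K : g.Site → g.Site → ℝ}
    (hT : HasMajorant blk T K) (f : X → ℝ) {s : ℝ} (hf : ∀ x, |f x| ≤ s) :
    HasMajorant blk (mulOp f * T) (fun a b => s * K a b) := by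
  intro y' μ B hμ x
  rw [Module.End.mul_apply, mulOp_apply, abs_mul, mul_assoc]
  exact mul_le_mul (hf x) (hT y' μ B hμ x) (abs_nonneg _) ((abs_nonneg _).trans (hf x))

/-- a multiplier bounded by `s ≥ 0` behind scales a majorant by `s` (the source `fμ` is block-supported with bound `sB`). [folklore] -/
private theorem hasMajorant_mulOp_right_le (blk : X → g.Site) {T : Module.End ℝ (X → ℝ)} {K : g.Site → g.Site → ℝ}
    (hT : HasMajorant blk T K) (f : X → ℝ) {s : ℝ} (hs : 0 ≤ s) (hf : ∀ x, |f x| ≤ s) :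
    HasMajorant blk (T * mulOp f) (fun a b => s * K a b) := by
  intro y' μ B hμ x
  have hμ' : BlockSupp blk (mulOp f μ) y' (s * B) := by
    refine ⟨mul_nonneg hs hμ.nonneg, fun x' hx' => ?_, fun x' hx' => ?_⟩
    · rw [mulOp_apply, abs_mul]
      exact mul_le_mul (hf x') (hμ.bound x' hx') (abs_nonneg _) hs
    · rw [mulOp_apply, hμ.off x' hx', mul_zero]
  rw [Module.End.mul_apply]
  refine (hT y' _ (s * B) hμ' x).trans (le_of_eq ?_)
  ring

/-- a majorant of `T` is a majorant of `−T`. [folklore] -/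
private theorem hasMajorant_neg (blk : X → g.Site) {T : Module.End ℝ (X → ℝ)} {K : g.Site → g.Site → ℝ}
    (hT : HasMajorant blk T K) : HasMajorant blk (-T) K := by
  intro y' μ B hμ x
  rw [LinearMap.neg_apply, Pi.neg_apply, abs_neg]
  exact hT y' μ B hμ x

variable (i : TSIdx d L hd hL a₀ a₁)

/-- **THE FIRST FACTOR OF THE (2.136)₂ CHAIN, `∇_λ(h G_□ ·)`, HAS THE MAJORANT `(s₀ + s₁)·A·e^{−δ₂|y−y′|_T}`** whenever `|h| ≤ s₀` and `|∇_λh| ≤ s₁`: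
`onFun ∇_λ * mulOp h * onFun G_□ = mulOp (S_λh) * onFun (∇_λG_□) + mulOp (∇_λh) * onFun G_□` (§3) and the two (2.133) members.
[cite: Balaban1984PropagatorsII, Prop. 2.6 (2.136) p.247 («|(∇GJ)(x)|»), (2.141) p.247, (2.133) p.247] -/
theorem firstFactor_Dl {R M δ A : ℝ} (lam : Fin i.P.d)
    (hG : HasMajorant (g := tsGeo i R M) (fun b : PBond i.P 0 => iterBlockOf i.j b.src) (onFun i.D.G) (fun y y' => A * Real.exp (-(δ * i.tdist y y'))))
    (hDG : HasMajorant (g := tsGeo i R M) (fun b : PBond i.P 0 => iterBlockOf i.j b.src) (onFun (i.Dl lam ∘ₗ i.D.G))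
      (fun y y' => A * Real.exp (-(δ * i.tdist y y'))))
    (h : PBond i.P 0 → ℝ) {s₀ s₁ : ℝ} (h0 : ∀ b, |h b| ≤ s₀) (h1 : ∀ b, |onFun (i.Dl lam) h b| ≤ s₁) :
    HasMajorant (g := tsGeo i R M) (fun b : PBond i.P 0 => iterBlockOf i.j b.src) (onFun (i.Dl lam) * mulOp h * onFun i.D.G)
      (fun y y' => (s₀ + s₁) * A * Real.exp (-(δ * i.tdist y y'))) := by
  have e : onFun (i.Dl lam) * mulOp h * onFun i.D.G =
      mulOp (fun b : PBond i.P 0 => h ⟨b.src.shift lam, b.dir⟩) * onFun (i.Dl lam ∘ₗ i.D.G) + mulOp (onFun (i.Dl lam) h) * onFun i.D.G := by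
    rw [Dl_mulOp, add_mul, mul_assoc]
    rfl
  rw [e]
  have hs₀ : ∀ b : PBond i.P 0, |(fun b : PBond i.P 0 => h ⟨b.src.shift lam, b.dir⟩) b| ≤ s₀ := fun b => h0 _
  exact hasMajorant_mono _ (hasMajorant_add _ (hasMajorant_mulOp_left_le _ hDG _ hs₀) (hasMajorant_mulOp_left_le _ hG _ h1))
    fun a b => le_of_eq (by ring)

/-- **THE LAST FACTOR OF THE (2.136)₃ CHAIN, `G_□ h ∇_λ*`, HAS THE MAJORANT `(s₀ + s₁)·A·e^{−δ₂|y−y′|_T}`** whenever `|h| ≤ s₀`, `0 ≤ s₀` and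
`|∇_λh| ≤ s₁`: `onFun G_□ * mulOp h * onFun ∇_λ* = onFun (G_□∇_λ*) * mulOp (S_λh) + onFun G_□ * mulOp (∇_λh)` (§3, `mulOp_Dla`) and §1.
[cite: Balaban1984PropagatorsII, Prop. 2.6 (2.136) p.247 («|(G∇*J)(x)|»), (2.141) p.247, (2.133) p.247] -/
theorem lastFactor_Dla {R M δ A : ℝ} (lam : Fin i.P.d)
    (hG : HasMajorant (g := tsGeo i R M) (fun b : PBond i.P 0 => iterBlockOf i.j b.src) (onFun i.D.G) (fun y y' => A * Real.exp (-(δ * i.tdist y y'))))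
    (hGD : HasMajorant (g := tsGeo i R M) (fun b : PBond i.P 0 => iterBlockOf i.j b.src) (onFun (i.D.G ∘ₗ i.Dla lam))
      (fun y y' => A * Real.exp (-(δ * i.tdist y y'))))
    (h : PBond i.P 0 → ℝ) {s₀ s₁ : ℝ} (hs₀ : 0 ≤ s₀) (h0 : ∀ b, |h b| ≤ s₀) (h1 : ∀ b, |onFun (i.Dl lam) h b| ≤ s₁) :
    HasMajorant (g := tsGeo i R M) (fun b : PBond i.P 0 => iterBlockOf i.j b.src) (onFun i.D.G * mulOp h * onFun (i.Dla lam))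
      (fun y y' => (s₀ + s₁) * A * Real.exp (-(δ * i.tdist y y'))) := by
  have e : onFun i.D.G * mulOp h * onFun (i.Dla lam) =
      onFun (i.D.G ∘ₗ i.Dla lam) * mulOp (fun b : PBond i.P 0 => h ⟨b.src.shift lam, b.dir⟩) + onFun i.D.G * mulOp (onFun (i.Dl lam) h) := by
    rw [mul_assoc, mulOp_Dla, mul_add, ← mul_assoc]
    rfl
  rw [e]
  have hs₀' : ∀ b : PBond i.P 0, |(fun b : PBond i.P 0 => h ⟨b.src.shift lam, b.dir⟩) b| ≤ s₀ := fun b => h0 _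
  -- `s₁ ≥ 0`: the bound `|∇_λh| ≤ s₁` read at one bond of the (inhabited) member torus
  have hs₁ : 0 ≤ s₁ := (abs_nonneg _).trans (h1 ⟨fun _ => 0, ⟨0, i.P.hd⟩⟩)
  exact hasMajorant_mono _ (hasMajorant_add _ (hasMajorant_mulOp_right_le _ hGD _ hs₀ hs₀') (hasMajorant_mulOp_right_le _ hG _ hs₁ h1))
    fun a b => le_of_eq (by ring)

/-- **THE FIRST FACTOR OF THE (2.136)₄ CHAIN, `Δ(h G_□ ·)`, HAS THE MAJORANT `(s₀ + 2(d+1)s₁ + s₂)·A·e^{−δ₂|y−y′|_T}`** whenever `|h| ≤ s₀`,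
`|∇_λh|, |∇_λ*h| ≤ s₁` (all `λ`) and `|Δh| ≤ s₂`: by gen 18's `leibniz_lapTS`,
`onFun Δ * mulOp h * onFun G_□ = mulOp h * onFun (ΔG_□) − Σ_λ [mulOp (∇_λh) * onFun (∇_λG_□) + mulOp (∇_λ*h) * onFun (∇_λ*G_□)] + mulOp (Δh) * onFun G_□`,
and the five (2.133) members (§2). [cite: Balaban1984PropagatorsII, Prop. 2.6 (2.136) p.247 («|(ΔGJ)(x)|»), (2.141) p.247, (2.92) p.239 (line 1), (2.133) p.247] -/
theorem firstFactor_lap {R M δ A : ℝ}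
    (hG : HasMajorant (g := tsGeo i R M) (fun b : PBond i.P 0 => iterBlockOf i.j b.src) (onFun i.D.G) (fun y y' => A * Real.exp (-(δ * i.tdist y y'))))
    (hDG : ∀ lam, HasMajorant (g := tsGeo i R M) (fun b : PBond i.P 0 => iterBlockOf i.j b.src) (onFun (i.Dl lam ∘ₗ i.D.G))
      (fun y y' => A * Real.exp (-(δ * i.tdist y y'))))
    (hDlaG : ∀ lam, HasMajorant (g := tsGeo i R M) (fun b : PBond i.P 0 => iterBlockOf i.j b.src) (onFun (i.Dla lam ∘ₗ i.D.G))
      (fun y y' => A * Real.exp (-(δ * i.tdist y y'))))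
    (hLapG : HasMajorant (g := tsGeo i R M) (fun b : PBond i.P 0 => iterBlockOf i.j b.src) (onFun (i.lapTS ∘ₗ i.D.G))
      (fun y y' => A * Real.exp (-(δ * i.tdist y y'))))
    (h : PBond i.P 0 → ℝ) {s₀ s₁ s₂ : ℝ} (h0 : ∀ b, |h b| ≤ s₀) (h1 : ∀ lam b, |onFun (i.Dl lam) h b| ≤ s₁)
    (h1' : ∀ lam b, |onFun (i.Dla lam) h b| ≤ s₁) (h2 : ∀ b, |onFun i.lapTS h b| ≤ s₂) :
    HasMajorant (g := tsGeo i R M) (fun b : PBond i.P 0 => iterBlockOf i.j b.src) (onFun i.lapTS * mulOp h * onFun i.D.G)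
      (fun y y' => (s₀ + 2 * (d + 1) * s₁ + s₂) * A * Real.exp (-(δ * i.tdist y y'))) := by
  -- the Leibniz expansion, multiplied by `G_□` on the right
  have e : onFun i.lapTS * mulOp h * onFun i.D.G =
      mulOp h * onFun (i.lapTS ∘ₗ i.D.G)
        + -(∑ lam : Fin i.P.d, (mulOp (onFun (i.Dl lam) h) * onFun (i.Dl lam ∘ₗ i.D.G) + mulOp (onFun (i.Dla lam) h) * onFun (i.Dla lam ∘ₗ i.D.G)))
        + mulOp (onFun i.lapTS h) * onFun i.D.G := by
    have hl := leibniz_lapTS i h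
    have e1 : onFun i.lapTS * mulOp h = mulOp h * onFun i.lapTS
        - ∑ lam : Fin i.P.d, (mulOp (onFun (i.Dl lam) h) * onFun (i.Dl lam) + mulOp (onFun (i.Dla lam) h) * onFun (i.Dla lam))
        + mulOp (onFun i.lapTS h) := by
      calc onFun i.lapTS * mulOp h = mulOp h * onFun i.lapTS - (mulOp h * onFun i.lapTS - onFun i.lapTS * mulOp h) := by abel
        _ = _ := by rw [hl]; abel
    rw [e1, add_mul, sub_mul, Finset.sum_mul, mul_assoc]
    simp only [add_mul, mul_assoc]
    rw [sub_eq_add_neg]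
    rfl
  rw [e]
  -- the sum of the `2(d+1)` first-difference terms
  have hsum : HasMajorant (g := tsGeo i R M) (fun b : PBond i.P 0 => iterBlockOf i.j b.src)
      (∑ lam : Fin i.P.d, (mulOp (onFun (i.Dl lam) h) * onFun (i.Dl lam ∘ₗ i.D.G) + mulOp (onFun (i.Dla lam) h) * onFun (i.Dla lam ∘ₗ i.D.G)))
      (fun y y' => ∑ _lam : Fin i.P.d, (s₁ * (A * Real.exp (-(δ * i.tdist y y'))) + s₁ * (A * Real.exp (-(δ * i.tdist y y'))))) :=
    hasMajorant_finsetSum (g := tsGeo i R M) _ (Finset.univ : Finset (Fin i.P.d)) _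
      (fun _ y y' => s₁ * (A * Real.exp (-(δ * i.tdist y y'))) + s₁ * (A * Real.exp (-(δ * i.tdist y y'))))
      fun lam _ => hasMajorant_add _ (hasMajorant_mulOp_left_le _ (hDG lam) _ (h1 lam)) (hasMajorant_mulOp_left_le _ (hDlaG lam) _ (h1' lam))
  have hmain := hasMajorant_add _ (hasMajorant_add _ (hasMajorant_mulOp_left_le _ hLapG _ h0) (hasMajorant_neg _ hsum))
    (hasMajorant_mulOp_left_le _ hG _ h2)
  refine hasMajorant_mono _ hmain fun a b => le_of_eq ?_
  simp only [Finset.sum_const, Finset.card_univ, Fintype.card_fin, nsmul_eq_mul]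
  have hdd : (i.P.d : ℝ) = d + 1 := by rw [show i.P.d = d + 1 from rfl]; push_cast; ring
  rw [hdd]
  ring

end Factors

/-! ## §5  The end factors for the whole family: ONE pair of constants -/

/-- **THE THREE DIFFERENTIATED END FACTORS OF (2.141) FOR EVERY MEMBER OF THE TWO-SCALE FAMILY, ONE `(δ₂, A)`**: there are `δ₂ > 0`, `A ≥ 0` on
`d, L, a₀, a₁` such that for every member `i`, every `R, M`, every direction `λ` and every real bond function `h` with `|h| ≤ s₀` (`s₀ ≥ 0`),
`|∇_μh|, |∇_μ*h| ≤ s₁` (all `μ`), `|Δh| ≤ s₂`: `∇_λhG_□`, `G_□h∇_λ*` have the majorant `(s₀ + s₁)·A·e^{−δ₂|y−y′|_T}` and `ΔhG_□` the majorant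
`(s₀ + 2(d+1)s₁ + s₂)·A·e^{−δ₂|y−y′|_T}` on `tsGeo i R M` — the member-side inputs of the (2.136)₂,₃,₄ chains.
[cite: Balaban1984PropagatorsII, Prop. 2.6 (2.136) p.247, (2.141) p.247, (2.133) p.247] -/
theorem endFactors_twoScale (d L : ℕ) (hd : 1 ≤ d + 1) (hL : Odd L ∧ 1 < L) {a₀ a₁ : ℝ} (ha₀ : 0 < a₀) (ha₁ : a₀ ≤ a₁) :
    ∃ δ : ℝ, 0 < δ ∧ ∃ A : ℝ, 0 ≤ A ∧ ∀ (i : TSIdx d L hd hL a₀ a₁) (R M : ℝ) (lam : Fin i.P.d) (h : PBond i.P 0 → ℝ) (s₀ s₁ s₂ : ℝ),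
      0 ≤ s₀ → (∀ b, |h b| ≤ s₀) → (∀ mu b, |onFun (i.Dl mu) h b| ≤ s₁) → (∀ mu b, |onFun (i.Dla mu) h b| ≤ s₁) →
      (∀ b, |onFun i.lapTS h b| ≤ s₂) →
        HasMajorant (g := tsGeo i R M) (fun b : PBond i.P 0 => iterBlockOf i.j b.src) (onFun (i.Dl lam) * mulOp h * onFun i.D.G)
            (fun y y' => (s₀ + s₁) * A * Real.exp (-(δ * i.tdist y y'))) ∧
          HasMajorant (g := tsGeo i R M) (fun b : PBond i.P 0 => iterBlockOf i.j b.src) (onFun i.D.G * mulOp h * onFun (i.Dla lam))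
            (fun y y' => (s₀ + s₁) * A * Real.exp (-(δ * i.tdist y y'))) ∧
          HasMajorant (g := tsGeo i R M) (fun b : PBond i.P 0 => iterBlockOf i.j b.src) (onFun i.lapTS * mulOp h * onFun i.D.G)
            (fun y y' => (s₀ + 2 * (d + 1) * s₁ + s₂) * A * Real.exp (-(δ * i.tdist y y'))) := by
  obtain ⟨δ, hδ, A, hA, h⟩ := ineq2133_five d L hd hL ha₀ ha₁
  refine ⟨δ, hδ, A, hA, fun i R M lam h' s₀ s₁ s₂ hs₀ h0 h1 h1' h2 => ?_⟩
  obtain ⟨hG, hDG, hDlaG, hGDla, hLapG⟩ := h i R M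
  exact ⟨firstFactor_Dl i lam hG (hDG lam) h' h0 (h1 lam), lastFactor_Dla i lam hG (hGDla lam) h' hs₀ h0 (h1 lam),
    firstFactor_lap i hG hDG hDlaG hLapG h' h0 h1 h1' h2⟩

end Literature.MathematicalPhysics.QuantumFieldTheory.Balaban1983to89.B6Ineq2133GDivLapTwoScaleV1

end
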